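import Summits.QuantumFields.BalabanUV.Beta.GAN24.T2RecOfUnitSplit
import Summits.QuantumFields.BalabanUV.Beta.GAN24.WSlotT2OfPieces
import Summits.QuantumFields.BalabanUV.Beta.MixedJetTablesPlug
import Summits.QuantumFields.BalabanUV.Beta.AxialDressingRootedBmHessian

/-!
# `BalabanUV.Beta.GAN24.T2RecHybridSplit` — binder row G-an2-4 ∕ (CONV-C), **CT-W (R-HYB): THE HYBRID CARRIER OF THE DRESSED AFFINE TOWER, ITS `hsplit`,
# AND THE CONTACT REMAINDER AS A LEVEL SUM OF ONE-MAP-DIFFERENCED TRANSPORTS**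
NOT IN PRINT; OUR BOOKKEEPING (road-P2 chair of row G-an2-4, unit `b2b-balaban-gan24-p2` gen 35, crux team (2); the OWNER gan24-p1 g22's RULING R-gan24p1-g22-1
«CT-W DESIGN v0» (`HOME/b2b-balaban-gan24-p1/gen22/CT-W-DESIGN-v0.md` §2 (R-HYB), §3 «F1 + the HYBRID carrier's `hsplit` (p2, GO)»)).  HONEST FRAMING (cell contract,
verbatim): «discharging `BetaPertH` makes Bałaban's UV stability UNCONDITIONAL — a real constructive-QFT result; it is NOT the continuum limit and NOT the Clay
problem.»  HONEST DEPENDENCY (verbatim): «continuum YM on T⁴ ⇐ BetaPertH ∧ nine spine estimates (0/9 proved); BetaPertH ⇐ (D1) ∧ (D4) ∧ CAP+tail; G-an2-4 gates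
asym, D1 and NE2/3/4.»

WHAT ([folklore] algebra; 0 `def`, 0 cited facts, 0 `def … : Prop`, 0 sorry).  (R-HYB) of the ruling: by multilinearity in the legs the dressed unit T₂ tower
`T̃_n = 𝒯^E(0,n) T̃_0 + Σ_{i<n} 𝒯^E(i+1,n−1−i) b̃_i` ((F1), `T2RecOfUnitSplit.unitS₂_T2RecOf_eq_transport_add_sum`; `𝒯^E` = composites of the DRESSED
`lin4 c₄ G̃_j Lc`) splits as `T̃_n = T^{hyb}_n + CONTACT_{W,n}`, where the HYBRID CARRIER `T^{hyb}_n := 𝒯^B(0,n) T̃_0 + Σ_{i<n} 𝒯^B(i+1,n−1−i) b̃_i` is the SAME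
affine tower with the UNDRESSED transport of record `𝒯^B` (composites of `lin4 c₄ K̃_j Lc`, `K̃_j = unitK_j (KInvStep Lc j)` — road W3's `TransportRows`) acting
on the SAME dressed sources, and `CONTACT_{W,n} := [𝒯^E − 𝒯^B](0,n) T̃_0 + Σ_{i<n} [𝒯^E − 𝒯^B](i+1,n−1−i) b̃_i`.
§1 (generic additive group `E`, maps `A B : ℕ → E → E` additive on a class `P`; leaf-01's `AffineUnroll` engine BY NAME): `hyb_zero`, **`hyb_hsplit`** (the hybrid
carrier satisfies road W3's END binder `hsplit` for the transport `B` — by `transport_zero`), `hyb_mem`, **`hyb_rec`** (it IS an affine tower: `T^{hyb}_{j+1} =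
B_j T^{hyb}_j + b_j`), `hyb_diff_eq_transport_add_sum` (its difference tower unrolled — END #2's `hsplit`), **`eq_hyb_add_contact`** (the split), **`transport_sub_transport_eq_sum`** (DUHAMEL FOR MAPS: `𝒯^A(m,k) x − 𝒯^B(m,k) x = Σ_{l<k}
𝒯^A(m+l+1, k−1−l) [(A_{m+l} − B_{m+l}) (𝒯^B(m,l) x)]` — every summand has EXACTLY ONE map differenced; the leg-level refinement inside `lin4_{G̃} − lin4_{K̃}` is the
OWNER's CT-W1 `SandwichLegTelescope`, NOT here).  §2 (generic `d`, bi-tables): **`shape_of_hybrid_rows`** — road W3's END #1 `WSlotT2OfPieces.shape_of_rows` THROUGH THE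
SPLIT: «T2Shape» of ANY carrier unrolled through `P` from END #1's rows for ANOTHER transport `Q` (`hTmarg`, `hTirr`), the source rows `hb`∕`hZ`, `h0`, AND a uniform
`LocStencil₂` bound `hct` on the contact remainder — constant `C_T·C₀ + C_T′·C_b·(1−ρ)⁻¹ + C_ct`.  §3 (generic `d`, an2's SLOTTED family `T2RecOf G S M`, letters
(DG)(LS)(LM)+border+mixed as in (F1)): **`unitS₂_T2RecOf_eq_hyb_add_contact_of_letters`** (the split at `A_j = lin4 c₄ (unitK_j (G j)) Lc`, `B_j = lin4 c₄ K̃_j Lc`),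
`bdd₄_source_of_letters`, **`transport_sub_transport_eq_sum_of_letters`** (Duhamel for each contact summand, class = bounded entries).  §4 (generic `d`, in-block root, the COMB family `T2RecAt d Lc (toSite r) …`
with `mixFFAt (toSite r) Lc`; (DG)(LS)(LM) and the mixed-table letter DISCHARGED — asym1's `decays_coDressKBmAt_KInvStep`, `OneStepKernelFamily.decays_KInvStep`, an2's
`locStencil_SpureRecAt` ∕ `vertexFamily_M1At`, an1's `MixedJetTablesPlug.hmix_an1`): **`unitS₂_T2RecAt_eq_hyb_add_contact`**, **`transport_sub_transport_eq_sum_comb`**.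
NOT HERE: the rows themselves — (F2) `Zfree (b̃_i)` (OPEN, the one new input of (R-HYB)), (F4) (`T2RecSourceRows`), (F3) = road W3's `TransportRows` for `𝒯^B` (TREE), the
contact bound (R-CT) (OPEN; CT-W1…W4 of the ruling), HYB-END (the OWNER's `T2HybridOfPieces`).  Discharges NOTHING of «T2Shape» ∕ «T2Drift» ∕ (hW, hWall); NEVER
«G-an2-4 closed» as (CONV-C); NOT D1, NOT `BetaPertH`, NOT continuum, NOT Clay; not in print.  2026-08-21.
-/

noncomputable section

open Finset
open scoped BigOperators
open Literature.MathematicalPhysics.QuantumFieldTheory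
open Literature.MathematicalPhysics.QuantumFieldTheory.Balaban1983to89
open Literature.MathematicalPhysics.QuantumFieldTheory.Balaban1983to89.Beta
open ExpKernelCalculus (MKer Decays BiLoc VertexFamily VertexFamily₂)
open OneStepResolventKernel (Fib LocStencil decays_mono)
open OneStepKernelFamily (KInvStep decays_KInvStep)
open AffineAveraging (box toSite)
open AveragingMixedJetTables (mixFFAt mixFFAt_inl_inr mixFFAt_inr)
open SecondOrderResponse (W2SymOfK LocStencilFM)
open BalabanCompositeJets (LocStencil₂)
open BalabanStepJetsSucc (mmRead)
open BalabanStepW2 (K3OfK M2Of)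
open Summit.QuantumFields.BalabanUV.Beta.HessKerDressedUnits (unitK unitS decays_unitK)
open Summit.QuantumFields.BalabanUV.Beta.SecondOrderUnits (unitM unitS₂ unitM₂)
open Summit.QuantumFields.BalabanUV.Beta.AxialDressingRooted (coDressKBmAt)
open Summit.QuantumFields.BalabanUV.Beta.SpineRooted (T2RecOf T2RecAt SpureRecAt M1At T2RecOf_comb locStencil_SpureRecAt vertexFamily_M1At)
open Summit.QuantumFields.BalabanUV.Beta.AxialDressingRooted (decays_coDressKBmAt_KInvStep)
open Summit.QuantumFields.BalabanUV.Beta.MixedJetTablesPlug (hmix_an1)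
open Summit.QuantumFields.BalabanUV.Beta.GAN24.CombesThomas (sfStep smStep)
open Summit.QuantumFields.BalabanUV.Beta.GAN24.T2RecursionAffine (lin4)
open Summit.QuantumFields.BalabanUV.Beta.GAN24.AffineUnroll
open Summit.QuantumFields.BalabanUV.Beta.GAN24.Lin4Additive (lin4_bdd lin4_add)
open Summit.QuantumFields.BalabanUV.Beta.GAN24.T2UnitSplitLevels (bdd₄_zero bdd₄_add bdd₄_sub lin4_add_of_bdd₄)
open Summit.QuantumFields.BalabanUV.Beta.GAN24.T2RecOfUnitSplit (unitS₂_T2RecOf_succ_eq_lin4_add step_data_of_letters bdd₄_unitS₂_T2RecOf_of_letters unitS₂_T2RecOf_eq_transport_add_sum_of_letters)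
open Summit.QuantumFields.BalabanUV.Beta.GAN24.WSlotT2OfPieces (shape_of_rows locStencil₂_add)

namespace Summit.QuantumFields.BalabanUV.Beta.GAN24.T2RecHybridSplit

/-! ## §1 Generic: the hybrid carrier, its `hsplit`, its one-step recursion, the split, Duhamel for maps -/

section Generic

variable {E : Type*} [AddCommGroup E] {A B : ℕ → E → E} {P : E → Prop}

/-- [folklore] Member `0` of the hybrid carrier is the initial datum (`transport_zero`, empty sum). -/
theorem hyb_zero (B : ℕ → E → E) (x₀ : E) (b : ℕ → E) :
    (fun n => transport B 0 n x₀ + ∑ m ∈ Finset.range n, transport B (m + 1) (n - 1 - m) (b m)) 0 = x₀ := by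
  simp

/-- [folklore] **THE HYBRID CARRIER SATISFIES ROAD W3's END BINDER `hsplit` FOR THE TRANSPORT `B`** (definitionally, after `hyb_zero`). -/
theorem hyb_hsplit (B : ℕ → E → E) (x₀ : E) (b : ℕ → E) (n : ℕ) :
    (fun n => transport B 0 n x₀ + ∑ m ∈ Finset.range n, transport B (m + 1) (n - 1 - m) (b m)) n =
      transport B 0 n ((fun n => transport B 0 n x₀ + ∑ m ∈ Finset.range n, transport B (m + 1) (n - 1 - m) (b m)) 0) +
        ∑ m ∈ Finset.range n, transport B (m + 1) (n - 1 - m) (b m) := by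
  simp

/-- [folklore] Every member of the hybrid carrier lies in the class (`transport_mem`, `sum_mem`). -/
theorem hyb_mem (hP0 : P 0) (hPadd : ∀ x y, P x → P y → P (x + y)) (hBP : ∀ j x, P x → P (B j x)) {x₀ : E} {b : ℕ → E}
    (hx₀ : P x₀) (hb : ∀ j, P (b j)) (n : ℕ) :
    P (transport B 0 n x₀ + ∑ m ∈ Finset.range n, transport B (m + 1) (n - 1 - m) (b m)) :=
  hPadd _ _ (transport_mem hBP 0 n hx₀) (sum_mem hP0 hPadd _ _ fun m _ => transport_mem hBP _ _ (hb m))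

/-- [folklore] **THE HYBRID CARRIER IS AN AFFINE TOWER**: `T^{hyb}_{j+1} = B_j T^{hyb}_j + b_j` (additivity of `B_j` on the class; the converse reading of
leaf-01's `AffineUnroll.eq_transport_add_sum`). -/
theorem hyb_rec (hP0 : P 0) (hPadd : ∀ x y, P x → P y → P (x + y)) (hBP : ∀ j x, P x → P (B j x))
    (hBadd : ∀ j x y, P x → P y → B j (x + y) = B j x + B j y) {x₀ : E} {b : ℕ → E} (hx₀ : P x₀) (hb : ∀ j, P (b j)) (j : ℕ) :
    transport B 0 (j + 1) x₀ + ∑ m ∈ Finset.range (j + 1), transport B (m + 1) (j + 1 - 1 - m) (b m) =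
      B j (transport B 0 j x₀ + ∑ m ∈ Finset.range j, transport B (m + 1) (j - 1 - m) (b m)) + b j := by
  have hmem : ∀ m ∈ Finset.range j, P (transport B (m + 1) (j - 1 - m) (b m)) := fun m _ => transport_mem hBP _ _ (hb m)
  rw [hBadd j _ _ (transport_mem hBP 0 j hx₀) (sum_mem hP0 hPadd _ _ hmem), map_sum_of_add hP0 hPadd (hBadd j) _ _ hmem,
    Finset.sum_range_succ, transport_succ, Nat.zero_add]
  have hlast : transport B (j + 1) (j + 1 - 1 - j) (b j) = b j := by
    rw [show j + 1 - 1 - j = 0 by omega, transport_zero]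
  rw [hlast, add_assoc]
  congr 2
  refine Finset.sum_congr rfl fun m hm => ?_
  have hm' : m < j := Finset.mem_range.mp hm
  rw [show j + 1 - 1 - m = (j - 1 - m) + 1 by omega, transport_succ]
  congr 1
  omega

/-- [folklore] **THE HYBRID CARRIER's DIFFERENCE TOWER UNROLLED** (road W3's (F1b) shape for END #2 `rate_of_rows`, at the SHIFTED transport `𝒯^B(m+1,k)`): with
`T^{hyb}` an affine tower (`hyb_rec`), leaf-01's `AffineUnroll.diff_eq_transport_add_sum` applies verbatim — forcing `(B_{m+1} − B_m) T^{hyb}_m + (b_{m+1} − b_m)`. -/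
theorem hyb_diff_eq_transport_add_sum (hP0 : P 0) (hPadd : ∀ x y, P x → P y → P (x + y)) (hPsub : ∀ x y, P x → P y → P (x - y))
    (hBP : ∀ j x, P x → P (B j x)) (hBadd : ∀ j x y, P x → P y → B j (x + y) = B j x + B j y) {x₀ : E} {b : ℕ → E} (hx₀ : P x₀)
    (hb : ∀ j, P (b j)) (n : ℕ) :
    (transport B 0 (n + 1) x₀ + ∑ m ∈ Finset.range (n + 1), transport B (m + 1) (n + 1 - 1 - m) (b m)) -
        (transport B 0 n x₀ + ∑ m ∈ Finset.range n, transport B (m + 1) (n - 1 - m) (b m)) =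
      transport B 1 n ((transport B 0 1 x₀ + ∑ m ∈ Finset.range 1, transport B (m + 1) (1 - 1 - m) (b m)) - x₀) +
        ∑ m ∈ Finset.range n, transport B (m + 2) (n - 1 - m)
          ((B (m + 1) (transport B 0 m x₀ + ∑ l ∈ Finset.range m, transport B (l + 1) (m - 1 - l) (b l)) -
              B m (transport B 0 m x₀ + ∑ l ∈ Finset.range m, transport B (l + 1) (m - 1 - l) (b l))) + (b (m + 1) - b m)) := by
  have h := diff_eq_transport_add_sum (A := B) (P := P)
    (x := fun n => transport B 0 n x₀ + ∑ m ∈ Finset.range n, transport B (m + 1) (n - 1 - m) (b m)) (b := b) hP0 hPadd hPsub hBP hBadd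
    (by simpa using hx₀) hb (fun j => hyb_rec hP0 hPadd hBP hBadd hx₀ hb j) n
  simpa using h

/-- [folklore] **THE HYBRID SPLIT** `x_n = T^{hyb}_n + CONTACT_n`: from the unrolled form of `x` through `A`, for ANY second family `B`. -/
theorem eq_hyb_add_contact (B : ℕ → E → E) {x b : ℕ → E} {n : ℕ}
    (hunroll : x n = transport A 0 n (x 0) + ∑ m ∈ Finset.range n, transport A (m + 1) (n - 1 - m) (b m)) :
    x n = (transport B 0 n (x 0) + ∑ m ∈ Finset.range n, transport B (m + 1) (n - 1 - m) (b m)) +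
      ((transport A 0 n (x 0) - transport B 0 n (x 0)) +
        ∑ m ∈ Finset.range n, (transport A (m + 1) (n - 1 - m) (b m) - transport B (m + 1) (n - 1 - m) (b m))) := by
  rw [hunroll, Finset.sum_sub_distrib]
  abel

/-- [folklore] **DUHAMEL FOR MAPS** (the contact summands as level sums with EXACTLY ONE map differenced): if the `A_j` are additive on a class `P` preserved by
the `A_j` and the `B_j` and closed under `−`, then for `x ∈ P`,
`𝒯^A(m,k) x − 𝒯^B(m,k) x = Σ_{l<k} 𝒯^A(m+l+1, k−1−l) [A_{m+l} (𝒯^B(m,l) x) − B_{m+l} (𝒯^B(m,l) x)]`. -/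
theorem transport_sub_transport_eq_sum (hP0 : P 0) (hPadd : ∀ x y, P x → P y → P (x + y)) (hPsub : ∀ x y, P x → P y → P (x - y))
    (hAP : ∀ j x, P x → P (A j x)) (hBP : ∀ j x, P x → P (B j x)) (hAadd : ∀ j x y, P x → P y → A j (x + y) = A j x + A j y)
    {x : E} (hx : P x) (m k : ℕ) :
    transport A m k x - transport B m k x =
      ∑ l ∈ Finset.range k, transport A (m + l + 1) (k - 1 - l) (A (m + l) (transport B m l x) - B (m + l) (transport B m l x)) := by
  induction k with
  | zero => simp
  | succ k ih =>
    have hmem : ∀ l ∈ Finset.range k, P (transport A (m + l + 1) (k - 1 - l) (A (m + l) (transport B m l x) - B (m + l) (transport B m l x))) :=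
      fun l _ => transport_mem hAP _ _ (hPsub _ _ (hAP _ _ (transport_mem hBP _ _ hx)) (hBP _ _ (transport_mem hBP _ _ hx)))
    have hsplit : A (m + k) (transport A m k x) = A (m + k) (transport A m k x - transport B m k x) + A (m + k) (transport B m k x) := by
      rw [← hAadd (m + k) _ _ (hPsub _ _ (transport_mem hAP _ _ hx) (transport_mem hBP _ _ hx)) (transport_mem hBP _ _ hx), sub_add_cancel]
    rw [transport_succ, transport_succ, hsplit, ih, map_sum_of_add hP0 hPadd (hAadd (m + k)) _ _ hmem, Finset.sum_range_succ,
      show k + 1 - 1 - k = 0 by omega, transport_zero, add_sub_assoc]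
    congr 1
    refine Finset.sum_congr rfl fun l hl => ?_
    have hl' : l < k := Finset.mem_range.mp hl
    rw [show k + 1 - 1 - l = (k - 1 - l) + 1 by omega, transport_succ]
    congr 1
    omega

end Generic

/-! ## §2 Generic `d`: road W3's END #1 THROUGH THE SPLIT -/

section Shape

variable {d : ℕ}

/-- NOT IN PRINT; OUR BOOKKEEPING ([folklore] `shape_of_rows` + `locStencil₂_add`).  **«T2Shape» OF A CARRIER UNROLLED THROUGH `P`, FROM ROAD W3's END #1 ROWS FOR ANOTHER
TRANSPORT `Q` AND A CONTACT BOUND**: if `T n = P 0 n (T 0) + Σ_{i<n} P (i+1) (n−1−i) (b i)` (`hsplitP`, (F1) for the DRESSED transport), the rows `hTmarg`∕`hTirr` of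
`WSlotT2OfPieces.shape_of_rows` hold for `Q` (for the comb family: road W3's `TransportRows` at the UNDRESSED `lin4` of record, TREE), the sources satisfy `hb`∕`hZ`, the
initial member `h0`, and the CONTACT REMAINDER `[P − Q](0,n) (T 0) + Σ_{i<n} [P − Q](i+1,n−1−i) (b i)` is a `LocStencil₂` family with ONE constant `C_ct` at the output
rate ((R-CT), OPEN), then every member is a `LocStencil₂` family with constant `C_T·C₀ + C_T′·C_b·(1−ρ)⁻¹ + C_ct` at the rate `δ_T`. -/
theorem shape_of_hybrid_rows (T b : ℕ → Fin (d + 1) → (Fin (d + 1) → ℤ) → Fin (d + 1) → (Fin (d + 1) → ℤ) → MKer (d + 1) (Fib d))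
    (P : ℕ → ℕ → (Fin (d + 1) → (Fin (d + 1) → ℤ) → Fin (d + 1) → (Fin (d + 1) → ℤ) → MKer (d + 1) (Fib d)) →
      Fin (d + 1) → (Fin (d + 1) → ℤ) → Fin (d + 1) → (Fin (d + 1) → ℤ) → MKer (d + 1) (Fib d))
    (B : ℕ → (Fin (d + 1) → (Fin (d + 1) → ℤ) → Fin (d + 1) → (Fin (d + 1) → ℤ) → MKer (d + 1) (Fib d)) →
      Fin (d + 1) → (Fin (d + 1) → ℤ) → Fin (d + 1) → (Fin (d + 1) → ℤ) → MKer (d + 1) (Fib d))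
    (Zfree : (Fin (d + 1) → (Fin (d + 1) → ℤ) → Fin (d + 1) → (Fin (d + 1) → ℤ) → MKer (d + 1) (Fib d)) → Prop)
    (mom : (Fin (d + 1) → (Fin (d + 1) → ℤ) → Fin (d + 1) → (Fin (d + 1) → ℤ) → MKer (d + 1) (Fib d)) → ℝ)
    {δin δT CT CT' ρ Cb C₀ Cct : ℝ} (hCT' : 0 ≤ CT') (hρ0 : 0 ≤ ρ) (hρ1 : ρ < 1)
    (hsplitP : ∀ n, T n = P 0 n (T 0) + ∑ i ∈ Finset.range n, P (i + 1) (n - 1 - i) (b i))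
    (hTmarg : ∀ (m k : ℕ) (X : Fin (d + 1) → (Fin (d + 1) → ℤ) → Fin (d + 1) → (Fin (d + 1) → ℤ) → MKer (d + 1) (Fib d)) (C : ℝ), 0 ≤ C →
      LocStencil₂ X C δin → LocStencil₂ (transport B m k X) (CT * C) δT)
    (hTirr : ∀ (m k : ℕ) (X : Fin (d + 1) → (Fin (d + 1) → ℤ) → Fin (d + 1) → (Fin (d + 1) → ℤ) → MKer (d + 1) (Fib d)) (C : ℝ), 0 ≤ C →
      LocStencil₂ X C δin → Zfree X → mom X ≤ C → LocStencil₂ (transport B m k X) (CT' * C * ρ ^ k) δT)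
    (hb : ∀ m, LocStencil₂ (b m) Cb δin ∧ mom (b m) ≤ Cb) (hZ : ∀ m, Zfree (b m)) (h0 : LocStencil₂ (T 0) C₀ δin)
    (hct : ∀ n, LocStencil₂ ((P 0 n (T 0) - transport B 0 n (T 0)) +
      ∑ i ∈ Finset.range n, (P (i + 1) (n - 1 - i) (b i) - transport B (i + 1) (n - 1 - i) (b i))) Cct δT)
    (n : ℕ) :
    LocStencil₂ (T n) (CT * C₀ + CT' * Cb * (1 - ρ)⁻¹ + Cct) δT := by
  have hsplit : T n = (transport B 0 n (T 0) + ∑ i ∈ Finset.range n, transport B (i + 1) (n - 1 - i) (b i)) +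
      ((P 0 n (T 0) - transport B 0 n (T 0)) + ∑ i ∈ Finset.range n, (P (i + 1) (n - 1 - i) (b i) - transport B (i + 1) (n - 1 - i) (b i))) := by
    rw [hsplitP n, Finset.sum_sub_distrib]
    abel
  rw [hsplit]
  refine locStencil₂_add ?_ (hct n)
  have h := shape_of_rows (fun n => transport B 0 n (T 0) + ∑ m ∈ Finset.range n, transport B (m + 1) (n - 1 - m) (b m)) b (transport B)
    Zfree mom hCT' hρ0 hρ1 (hyb_hsplit B (T 0) b) hTmarg hTirr hb hZ (by simpa using h0) n
  simpa using h

end Shape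

/-! ## §3 Generic `d`: the split and Duhamel for an2's SLOTTED family `T2RecOf G S M`, modulo the letters -/

section Slotted

variable {d : ℕ} {Lc : ℕ} [NeZero Lc] (G K : ℕ → MKer (d + 1) (Fib d)) (S : ℕ → Fin (d + 1) → (Fin (d + 1) → ℤ) → MKer (d + 1) (Fib d))
  (M : ℕ → Fin (d + 1) → (Fin (d + 1) → ℤ) → MKer (d + 1) (Fib d)) (cE₂ cB : ℝ) (Tc : Fin 4 → Fin 4 → Fin 4 → Fin 4 → ℝ)
  (vh₂S mixFF : Fin (d + 1) → (Fin (d + 1) → ℤ) → Fin (d + 1) → (Fin (d + 1) → ℤ) → MKer (d + 1) (Fib d))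

/-- NOT IN PRINT; OUR BOOKKEEPING ([folklore] (F1) `T2RecOfUnitSplit.unitS₂_T2RecOf_eq_transport_add_sum_of_letters` + `eq_hyb_add_contact`).  **THE HYBRID SPLIT OF THE
SLOTTED UNIT T₂ TOWER**: for ANY second kernel family `K` (for the comb family: `K j = KInvStep Lc j`, road W3's transport of record), with `𝒯^E` the composites of the
dressed `lin4 c₄ (unitK_j (G j)) Lc`, `𝒯^B` those of `lin4 c₄ (unitK_j (K j)) Lc`, and `b̃_i` the `T̃`-free source of (F1):
`T̃_n = (𝒯^B(0,n) T̃_0 + Σ_{i<n} 𝒯^B(i+1,n−1−i) b̃_i) + ([𝒯^E − 𝒯^B](0,n) T̃_0 + Σ_{i<n} [𝒯^E − 𝒯^B](i+1,n−1−i) b̃_i)`.  Letters as in (F1): (DG)(LS)(LM), the border's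
off-diagonality `hBff`∕`hBmm` and shape `hB`, the mixed table `hmix`; NOTHING is asked of `K`. -/
theorem unitS₂_T2RecOf_eq_hyb_add_contact_of_letters (hLc : 1 ≤ Lc)
    (hBff : ∀ κ u κ' u' x z (α β : Fin (d + 1)), vh₂S κ u κ' u' x z (Sum.inl α) (Sum.inl β) = 0)
    (hBmm : ∀ κ u κ' u' x z (μ ν : Fin (d + 1)), vh₂S κ u κ' u' x z (Sum.inr μ) (Sum.inr ν) = 0)
    (hG : ∀ j : ℕ, ∃ δ C : ℝ, 0 < δ ∧ 0 ≤ C ∧ Decays (G j) C δ)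
    (hS : ∀ j : ℕ, ∃ Cs δ : ℝ, 0 < δ ∧ LocStencil (S j) Cs δ) (hM : ∀ j : ℕ, ∃ CM δ : ℝ, 0 < δ ∧ VertexFamily (M j) Lc CM δ)
    (hB : ∃ C δ : ℝ, 0 < δ ∧ LocStencil₂ vh₂S C δ) (hmix : ∃ C δ : ℝ, 0 < δ ∧ LocStencilFM Lc mixFF C δ) (n : ℕ) :
    (unitS₂ (sfStep Lc n) (smStep d Lc n) (T2RecOf d Lc G S M cE₂ cB Tc vh₂S mixFF n)) =
      (transport (fun j => lin4 (cE₂ * (Lc : ℝ) ^ (2 * (d + 1))) (unitK (sfStep Lc j) (smStep d Lc j) (K j)) Lc) 0 n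
          (unitS₂ (sfStep Lc 0) (smStep d Lc 0) (T2RecOf d Lc G S M cE₂ cB Tc vh₂S mixFF 0)) +
        ∑ i ∈ Finset.range n, transport (fun j => lin4 (cE₂ * (Lc : ℝ) ^ (2 * (d + 1))) (unitK (sfStep Lc j) (smStep d Lc j) (K j)) Lc) (i + 1) (n - 1 - i)
          (fun κ u κ' u' => (cE₂ * (Lc : ℝ) ^ (2 * (d + 1))) • mmRead Lc (K3OfK (unitK (sfStep Lc i) (smStep d Lc i) (G i)) Lc
            (unitS (sfStep Lc i) (smStep d Lc i) (S i)) (unitM (sfStep Lc i) (smStep d Lc i) (M i)) (W2SymOfK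
            (unitK (sfStep Lc i) (smStep d Lc i) (G i)) Lc (unitS (sfStep Lc i) (smStep d Lc i) (S i))
            (unitM (sfStep Lc i) (smStep d Lc i) (M i)) 0
            (unitM₂ (sfStep Lc i) (smStep d Lc i) (M2Of d Lc mixFF i))) κ u κ' u') + cB • vh₂S κ u κ' u')) +
      ((transport (fun j => lin4 (cE₂ * (Lc : ℝ) ^ (2 * (d + 1))) (unitK (sfStep Lc j) (smStep d Lc j) (G j)) Lc) 0 n
            (unitS₂ (sfStep Lc 0) (smStep d Lc 0) (T2RecOf d Lc G S M cE₂ cB Tc vh₂S mixFF 0)) -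
          transport (fun j => lin4 (cE₂ * (Lc : ℝ) ^ (2 * (d + 1))) (unitK (sfStep Lc j) (smStep d Lc j) (K j)) Lc) 0 n
            (unitS₂ (sfStep Lc 0) (smStep d Lc 0) (T2RecOf d Lc G S M cE₂ cB Tc vh₂S mixFF 0))) +
        ∑ i ∈ Finset.range n, (transport (fun j => lin4 (cE₂ * (Lc : ℝ) ^ (2 * (d + 1))) (unitK (sfStep Lc j) (smStep d Lc j) (G j)) Lc) (i + 1) (n - 1 - i)
            (fun κ u κ' u' => (cE₂ * (Lc : ℝ) ^ (2 * (d + 1))) • mmRead Lc (K3OfK (unitK (sfStep Lc i) (smStep d Lc i) (G i)) Lc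
            (unitS (sfStep Lc i) (smStep d Lc i) (S i)) (unitM (sfStep Lc i) (smStep d Lc i) (M i)) (W2SymOfK
            (unitK (sfStep Lc i) (smStep d Lc i) (G i)) Lc (unitS (sfStep Lc i) (smStep d Lc i) (S i))
            (unitM (sfStep Lc i) (smStep d Lc i) (M i)) 0
            (unitM₂ (sfStep Lc i) (smStep d Lc i) (M2Of d Lc mixFF i))) κ u κ' u') + cB • vh₂S κ u κ' u') -
          transport (fun j => lin4 (cE₂ * (Lc : ℝ) ^ (2 * (d + 1))) (unitK (sfStep Lc j) (smStep d Lc j) (K j)) Lc) (i + 1) (n - 1 - i)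
            (fun κ u κ' u' => (cE₂ * (Lc : ℝ) ^ (2 * (d + 1))) • mmRead Lc (K3OfK (unitK (sfStep Lc i) (smStep d Lc i) (G i)) Lc
            (unitS (sfStep Lc i) (smStep d Lc i) (S i)) (unitM (sfStep Lc i) (smStep d Lc i) (M i)) (W2SymOfK
            (unitK (sfStep Lc i) (smStep d Lc i) (G i)) Lc (unitS (sfStep Lc i) (smStep d Lc i) (S i))
            (unitM (sfStep Lc i) (smStep d Lc i) (M i)) 0
            (unitM₂ (sfStep Lc i) (smStep d Lc i) (M2Of d Lc mixFF i))) κ u κ' u') + cB • vh₂S κ u κ' u'))) :=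
  eq_hyb_add_contact (A := (fun j => lin4 (cE₂ * (Lc : ℝ) ^ (2 * (d + 1))) (unitK (sfStep Lc j) (smStep d Lc j) (G j)) Lc))
    (fun j => lin4 (cE₂ * (Lc : ℝ) ^ (2 * (d + 1))) (unitK (sfStep Lc j) (smStep d Lc j) (K j)) Lc)
    (x := fun j => (unitS₂ (sfStep Lc j) (smStep d Lc j) (T2RecOf d Lc G S M cE₂ cB Tc vh₂S mixFF j)))
    (b := fun i => (fun κ u κ' u' => (cE₂ * (Lc : ℝ) ^ (2 * (d + 1))) • mmRead Lc (K3OfK (unitK (sfStep Lc i) (smStep d Lc i) (G i)) Lc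
            (unitS (sfStep Lc i) (smStep d Lc i) (S i)) (unitM (sfStep Lc i) (smStep d Lc i) (M i)) (W2SymOfK
            (unitK (sfStep Lc i) (smStep d Lc i) (G i)) Lc (unitS (sfStep Lc i) (smStep d Lc i) (S i))
            (unitM (sfStep Lc i) (smStep d Lc i) (M i)) 0
            (unitM₂ (sfStep Lc i) (smStep d Lc i) (M2Of d Lc mixFF i))) κ u κ' u') + cB • vh₂S κ u κ' u'))
    (unitS₂_T2RecOf_eq_transport_add_sum_of_letters G S M cE₂ cB Tc hLc hBff hBmm hG hS hM hB hmix n)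

/-- [folklore] **BOUNDED ENTRIES OF EVERY SOURCE `b̃_i` FROM THE LETTERS** (`b̃_i = T̃_{i+1} − lin4 c₄ G̃_i Lc T̃_i` by (F1)'s `unitS₂_T2RecOf_succ_eq_lin4_add`; `bdd₄_sub`,
`lin4_bdd`). -/
theorem bdd₄_source_of_letters (Tc : Fin 4 → Fin 4 → Fin 4 → Fin 4 → ℝ) (hLc : 1 ≤ Lc)
    (hBff : ∀ κ u κ' u' x z (α β : Fin (d + 1)), vh₂S κ u κ' u' x z (Sum.inl α) (Sum.inl β) = 0)
    (hBmm : ∀ κ u κ' u' x z (μ ν : Fin (d + 1)), vh₂S κ u κ' u' x z (Sum.inr μ) (Sum.inr ν) = 0)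
    (hG : ∀ j : ℕ, ∃ δ C : ℝ, 0 < δ ∧ 0 ≤ C ∧ Decays (G j) C δ)
    (hS : ∀ j : ℕ, ∃ Cs δ : ℝ, 0 < δ ∧ LocStencil (S j) Cs δ) (hM : ∀ j : ℕ, ∃ CM δ : ℝ, 0 < δ ∧ VertexFamily (M j) Lc CM δ)
    (hB : ∃ C δ : ℝ, 0 < δ ∧ LocStencil₂ vh₂S C δ) (hmix : ∃ C δ : ℝ, 0 < δ ∧ LocStencilFM Lc mixFF C δ) (i : ℕ) :
    ∃ B : ℝ, ∀ κ u κ' u' x z a b, |(fun κ u κ' u' => (cE₂ * (Lc : ℝ) ^ (2 * (d + 1))) • mmRead Lc (K3OfK (unitK (sfStep Lc i) (smStep d Lc i) (G i)) Lc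
            (unitS (sfStep Lc i) (smStep d Lc i) (S i)) (unitM (sfStep Lc i) (smStep d Lc i) (M i)) (W2SymOfK
            (unitK (sfStep Lc i) (smStep d Lc i) (G i)) Lc (unitS (sfStep Lc i) (smStep d Lc i) (S i))
            (unitM (sfStep Lc i) (smStep d Lc i) (M i)) 0
            (unitM₂ (sfStep Lc i) (smStep d Lc i) (M2Of d Lc mixFF i))) κ u κ' u') + cB • vh₂S κ u κ' u') κ u κ' u' x z a b| ≤ B := by
  obtain ⟨C, δ, C₀, C₁, hδ, hK, h₀, hW⟩ := step_data_of_letters G S M cE₂ cB Tc hLc hG hS hM hB hmix i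
  have e : (fun κ u κ' u' => (cE₂ * (Lc : ℝ) ^ (2 * (d + 1))) • mmRead Lc (K3OfK (unitK (sfStep Lc i) (smStep d Lc i) (G i)) Lc
            (unitS (sfStep Lc i) (smStep d Lc i) (S i)) (unitM (sfStep Lc i) (smStep d Lc i) (M i)) (W2SymOfK
            (unitK (sfStep Lc i) (smStep d Lc i) (G i)) Lc (unitS (sfStep Lc i) (smStep d Lc i) (S i))
            (unitM (sfStep Lc i) (smStep d Lc i) (M i)) 0
            (unitM₂ (sfStep Lc i) (smStep d Lc i) (M2Of d Lc mixFF i))) κ u κ' u') + cB • vh₂S κ u κ' u') =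
      (unitS₂ (sfStep Lc (i + 1)) (smStep d Lc (i + 1)) (T2RecOf d Lc G S M cE₂ cB Tc vh₂S mixFF (i + 1))) -
        lin4 (cE₂ * (Lc : ℝ) ^ (2 * (d + 1))) (unitK (sfStep Lc i) (smStep d Lc i) (G i)) Lc
          (unitS₂ (sfStep Lc i) (smStep d Lc i) (T2RecOf d Lc G S M cE₂ cB Tc vh₂S mixFF i)) := by
    rw [unitS₂_T2RecOf_succ_eq_lin4_add G S M cE₂ cB Tc vh₂S mixFF hBff hBmm i hδ hK h₀ hW, add_sub_cancel_left]
  rw [e]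
  exact bdd₄_sub (bdd₄_unitS₂_T2RecOf_of_letters G S M cE₂ cB Tc hLc hG hS hM hB hmix (i + 1))
    (lin4_bdd hK hδ _ Lc (bdd₄_unitS₂_T2RecOf_of_letters G S M cE₂ cB Tc hLc hG hS hM hB hmix i))

omit [NeZero Lc] in
/-- NOT IN PRINT; OUR BOOKKEEPING ([folklore] `transport_sub_transport_eq_sum` on the class of bounded bi-tables; `lin4_bdd`, `lin4_add_of_bdd₄`, `decays_unitK`).
**DUHAMEL FOR THE CONTACT SUMMANDS OF THE SLOTTED TOWER**: for every bounded bi-table `X` (the initial member `T̃_0` and every source `b̃_i` are such —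
`T2RecOfUnitSplit.bdd₄_unitS₂_T2RecOf_of_letters`, `bdd₄_source_of_letters`) and every `(m, k)`,
`𝒯^E(m,k) X − 𝒯^B(m,k) X = Σ_{l<k} 𝒯^E(m+l+1, k−1−l) [(lin4 c₄ G̃_{m+l} Lc − lin4 c₄ K̃_{m+l} Lc) (𝒯^B(m,l) X)]` — EXACTLY ONE dressed-minus-undressed map per summand,
undressed composites to its right, dressed composites to its left.  Letters: (DG) for `G` AND for `K`. -/
theorem transport_sub_transport_eq_sum_of_letters (hG : ∀ j : ℕ, ∃ δ C : ℝ, 0 < δ ∧ 0 ≤ C ∧ Decays (G j) C δ)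
    (hK : ∀ j : ℕ, ∃ δ C : ℝ, 0 < δ ∧ 0 ≤ C ∧ Decays (K j) C δ)
    {X : Fin (d + 1) → (Fin (d + 1) → ℤ) → Fin (d + 1) → (Fin (d + 1) → ℤ) → MKer (d + 1) (Fib d)}
    (hX : ∃ B : ℝ, ∀ κ u κ' u' x z a b, |X κ u κ' u' x z a b| ≤ B) (m k : ℕ) :
    transport (fun j => lin4 (cE₂ * (Lc : ℝ) ^ (2 * (d + 1))) (unitK (sfStep Lc j) (smStep d Lc j) (G j)) Lc) m k X -
        transport (fun j => lin4 (cE₂ * (Lc : ℝ) ^ (2 * (d + 1))) (unitK (sfStep Lc j) (smStep d Lc j) (K j)) Lc) m k X =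
      ∑ l ∈ Finset.range k, transport (fun j => lin4 (cE₂ * (Lc : ℝ) ^ (2 * (d + 1))) (unitK (sfStep Lc j) (smStep d Lc j) (G j)) Lc) (m + l + 1) (k - 1 - l)
        (lin4 (cE₂ * (Lc : ℝ) ^ (2 * (d + 1))) (unitK (sfStep Lc (m + l)) (smStep d Lc (m + l)) (G (m + l))) Lc
            (transport (fun j => lin4 (cE₂ * (Lc : ℝ) ^ (2 * (d + 1))) (unitK (sfStep Lc j) (smStep d Lc j) (K j)) Lc) m l X) -
          lin4 (cE₂ * (Lc : ℝ) ^ (2 * (d + 1))) (unitK (sfStep Lc (m + l)) (smStep d Lc (m + l)) (K (m + l))) Lc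
            (transport (fun j => lin4 (cE₂ * (Lc : ℝ) ^ (2 * (d + 1))) (unitK (sfStep Lc j) (smStep d Lc j) (K j)) Lc) m l X)) := by
  have hGu : ∀ j, ∃ C δ : ℝ, 0 < δ ∧ Decays (unitK (sfStep Lc j) (smStep d Lc j) (G j)) C δ := fun j => by
    obtain ⟨δ, C, hδ, -, h⟩ := hG j
    exact ⟨_, δ, hδ, decays_unitK (sf := sfStep Lc j) (sm := smStep d Lc j) h⟩
  have hKu : ∀ j, ∃ C δ : ℝ, 0 < δ ∧ Decays (unitK (sfStep Lc j) (smStep d Lc j) (K j)) C δ := fun j => by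
    obtain ⟨δ, C, hδ, -, h⟩ := hK j
    exact ⟨_, δ, hδ, decays_unitK (sf := sfStep Lc j) (sm := smStep d Lc j) h⟩
  refine transport_sub_transport_eq_sum (A := (fun j => lin4 (cE₂ * (Lc : ℝ) ^ (2 * (d + 1))) (unitK (sfStep Lc j) (smStep d Lc j) (G j)) Lc))
    (B := (fun j => lin4 (cE₂ * (Lc : ℝ) ^ (2 * (d + 1))) (unitK (sfStep Lc j) (smStep d Lc j) (K j)) Lc))
    (P := fun X => ∃ B : ℝ, ∀ κ u κ' u' x z a b, |X κ u κ' u' x z a b| ≤ B) bdd₄_zero (fun _ _ => bdd₄_add) (fun _ _ => bdd₄_sub)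
    (fun j Y hY => ?_) (fun j Y hY => ?_) (fun j Y Z hY hZ => ?_) hX m k
  · obtain ⟨C, δ, hδ, h⟩ := hGu j
    exact lin4_bdd h hδ _ Lc hY
  · obtain ⟨C, δ, hδ, h⟩ := hKu j
    exact lin4_bdd h hδ _ Lc hY
  · obtain ⟨C, δ, hδ, h⟩ := hGu j
    exact lin4_add_of_bdd₄ h hδ _ Lc hY hZ

end Slotted

/-! ## §4 The COMB family (generic `d`, in-block root): letters discharged -/

section Comb

variable {d : ℕ} {Lc : ℕ} [NeZero Lc] {r : Fin (d + 1) → ℕ}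

/-- NOT IN PRINT; OUR BOOKKEEPING ([folklore] `unitS₂_T2RecOf_eq_hyb_add_contact_of_letters` at the comb data through an2's bridge `RecursiveWSlot.T2RecOf_comb`; (DG)(LS)(LM) and
the mixed-table letter DISCHARGED — asym1's `decays_coDressKBmAt_KInvStep`, an2's `locStencil_SpureRecAt` ∕ `vertexFamily_M1At`, an1's `MixedJetTablesPlug.hmix_an1`).
**THE HYBRID SPLIT OF an2's COMB TOWER `unitS₂_n (T2RecAt d Lc (toSite r) …)`** (any root in the block, any `(cE, cVH, cΛ, cE₂, cB)`, any initial table `Tc`, any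
OFF-DIAGONAL `LocStencil₂` border `vh₂S` — an1's `vh₂SAn1 Lc` at the literal): the hybrid carrier's transport is road W3's transport OF RECORD (composites of
`lin4 c₄ (unitK_j (KInvStep Lc j)) Lc` — at `d = 3` its END #1 ∕ #2 rows are `TransportRows.transport_rows_three`, TREE, under the pin `|cE₂| ≤ Lc^8`); the sources are the
dressed `b̃_i`; the contact remainder displays EXACTLY the dressed-minus-undressed composites ((R-CT)'s object). -/
theorem unitS₂_T2RecAt_eq_hyb_add_contact (hLc : 1 ≤ Lc) (hr : r ∈ box (d + 1) Lc) (cE cVH cΛ cE₂ cB : ℝ) (Tc : Fin 4 → Fin 4 → Fin 4 → Fin 4 → ℝ)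
    {vh₂S : Fin (d + 1) → (Fin (d + 1) → ℤ) → Fin (d + 1) → (Fin (d + 1) → ℤ) → MKer (d + 1) (Fib d)}
    (hBff : ∀ κ u κ' u' x z (α β : Fin (d + 1)), vh₂S κ u κ' u' x z (Sum.inl α) (Sum.inl β) = 0)
    (hBmm : ∀ κ u κ' u' x z (μ ν : Fin (d + 1)), vh₂S κ u κ' u' x z (Sum.inr μ) (Sum.inr ν) = 0)
    (hB : ∃ C δ : ℝ, 0 < δ ∧ LocStencil₂ vh₂S C δ) (n : ℕ) :
    (unitS₂ (sfStep Lc n) (smStep d Lc n) (T2RecAt d Lc (toSite r) cE cVH cΛ cE₂ cB Tc vh₂S (mixFFAt (toSite r) Lc) n)) =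
      (transport (fun j => lin4 (cE₂ * (Lc : ℝ) ^ (2 * (d + 1))) (unitK (sfStep Lc j) (smStep d Lc j) (KInvStep (d := d) Lc j)) Lc) 0 n
          (unitS₂ (sfStep Lc 0) (smStep d Lc 0) (T2RecAt d Lc (toSite r) cE cVH cΛ cE₂ cB Tc vh₂S (mixFFAt (toSite r) Lc) 0)) +
        ∑ i ∈ Finset.range n, transport (fun j => lin4 (cE₂ * (Lc : ℝ) ^ (2 * (d + 1))) (unitK (sfStep Lc j) (smStep d Lc j) (KInvStep (d := d) Lc j)) Lc) (i + 1) (n - 1 - i)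
          (fun κ u κ' u' => (cE₂ * (Lc : ℝ) ^ (2 * (d + 1))) • mmRead Lc (K3OfK (unitK (sfStep Lc i) (smStep d Lc i) (coDressKBmAt (toSite r) Lc (KInvStep (d := d) Lc i))) Lc
            (unitS (sfStep Lc i) (smStep d Lc i) (SpureRecAt d Lc (toSite r) cE cVH cΛ i)) (unitM (sfStep Lc i) (smStep d Lc i) (M1At d Lc (toSite r) cΛ i)) (W2SymOfK
            (unitK (sfStep Lc i) (smStep d Lc i) (coDressKBmAt (toSite r) Lc (KInvStep (d := d) Lc i))) Lc (unitS (sfStep Lc i) (smStep d Lc i) (SpureRecAt d Lc (toSite r) cE cVH cΛ i))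
            (unitM (sfStep Lc i) (smStep d Lc i) (M1At d Lc (toSite r) cΛ i)) 0
            (unitM₂ (sfStep Lc i) (smStep d Lc i) (M2Of d Lc (mixFFAt (toSite r) Lc) i))) κ u κ' u') + cB • vh₂S κ u κ' u')) +
      ((transport (fun j => lin4 (cE₂ * (Lc : ℝ) ^ (2 * (d + 1))) (unitK (sfStep Lc j) (smStep d Lc j) (coDressKBmAt (toSite r) Lc (KInvStep (d := d) Lc j))) Lc) 0 n
            (unitS₂ (sfStep Lc 0) (smStep d Lc 0) (T2RecAt d Lc (toSite r) cE cVH cΛ cE₂ cB Tc vh₂S (mixFFAt (toSite r) Lc) 0)) -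
          transport (fun j => lin4 (cE₂ * (Lc : ℝ) ^ (2 * (d + 1))) (unitK (sfStep Lc j) (smStep d Lc j) (KInvStep (d := d) Lc j)) Lc) 0 n
            (unitS₂ (sfStep Lc 0) (smStep d Lc 0) (T2RecAt d Lc (toSite r) cE cVH cΛ cE₂ cB Tc vh₂S (mixFFAt (toSite r) Lc) 0))) +
        ∑ i ∈ Finset.range n, (transport (fun j => lin4 (cE₂ * (Lc : ℝ) ^ (2 * (d + 1))) (unitK (sfStep Lc j) (smStep d Lc j) (coDressKBmAt (toSite r) Lc (KInvStep (d := d) Lc j))) Lc) (i + 1) (n - 1 - i)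
            (fun κ u κ' u' => (cE₂ * (Lc : ℝ) ^ (2 * (d + 1))) • mmRead Lc (K3OfK (unitK (sfStep Lc i) (smStep d Lc i) (coDressKBmAt (toSite r) Lc (KInvStep (d := d) Lc i))) Lc
            (unitS (sfStep Lc i) (smStep d Lc i) (SpureRecAt d Lc (toSite r) cE cVH cΛ i)) (unitM (sfStep Lc i) (smStep d Lc i) (M1At d Lc (toSite r) cΛ i)) (W2SymOfK
            (unitK (sfStep Lc i) (smStep d Lc i) (coDressKBmAt (toSite r) Lc (KInvStep (d := d) Lc i))) Lc (unitS (sfStep Lc i) (smStep d Lc i) (SpureRecAt d Lc (toSite r) cE cVH cΛ i))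
            (unitM (sfStep Lc i) (smStep d Lc i) (M1At d Lc (toSite r) cΛ i)) 0
            (unitM₂ (sfStep Lc i) (smStep d Lc i) (M2Of d Lc (mixFFAt (toSite r) Lc) i))) κ u κ' u') + cB • vh₂S κ u κ' u') -
          transport (fun j => lin4 (cE₂ * (Lc : ℝ) ^ (2 * (d + 1))) (unitK (sfStep Lc j) (smStep d Lc j) (KInvStep (d := d) Lc j)) Lc) (i + 1) (n - 1 - i)
            (fun κ u κ' u' => (cE₂ * (Lc : ℝ) ^ (2 * (d + 1))) • mmRead Lc (K3OfK (unitK (sfStep Lc i) (smStep d Lc i) (coDressKBmAt (toSite r) Lc (KInvStep (d := d) Lc i))) Lc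
            (unitS (sfStep Lc i) (smStep d Lc i) (SpureRecAt d Lc (toSite r) cE cVH cΛ i)) (unitM (sfStep Lc i) (smStep d Lc i) (M1At d Lc (toSite r) cΛ i)) (W2SymOfK
            (unitK (sfStep Lc i) (smStep d Lc i) (coDressKBmAt (toSite r) Lc (KInvStep (d := d) Lc i))) Lc (unitS (sfStep Lc i) (smStep d Lc i) (SpureRecAt d Lc (toSite r) cE cVH cΛ i))
            (unitM (sfStep Lc i) (smStep d Lc i) (M1At d Lc (toSite r) cΛ i)) 0
            (unitM₂ (sfStep Lc i) (smStep d Lc i) (M2Of d Lc (mixFFAt (toSite r) Lc) i))) κ u κ' u') + cB • vh₂S κ u κ' u'))) := by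
  have h := unitS₂_T2RecOf_eq_hyb_add_contact_of_letters (fun j => coDressKBmAt (toSite r) Lc (KInvStep (d := d) Lc j)) (fun j => KInvStep (d := d) Lc j)
    (SpureRecAt d Lc (toSite r) cE cVH cΛ) (M1At d Lc (toSite r) cΛ) cE₂ cB Tc vh₂S (mixFFAt (toSite r) Lc) hLc hBff hBmm
    (fun j => decays_coDressKBmAt_KInvStep (d := d) hr j) (fun j => locStencil_SpureRecAt hLc hr cE cVH cΛ j)
    (fun j => ⟨_, 1, one_pos, vertexFamily_M1At hLc hr cΛ j zero_le_one⟩) hB (hmix_an1 hLc hr) n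
  simp only [T2RecOf_comb] at h
  exact h

/-- NOT IN PRINT; OUR BOOKKEEPING.  **DUHAMEL FOR THE COMB TOWER's CONTACT SUMMANDS** (`transport_sub_transport_eq_sum_of_letters` with (DG) for the dressed kernels — asym1 — and
for `KInvStep` — `OneStepKernelFamily.decays_KInvStep` — DISCHARGED): for every bounded bi-table `X` and every `(m, k)`, the dressed-minus-undressed composite is the
level sum of composites with EXACTLY ONE `lin4 c₄ G̃_{m+l} Lc − lin4 c₄ K̃_{m+l} Lc`. -/
theorem transport_sub_transport_eq_sum_comb (hr : r ∈ box (d + 1) Lc) (cE₂ : ℝ)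
    {X : Fin (d + 1) → (Fin (d + 1) → ℤ) → Fin (d + 1) → (Fin (d + 1) → ℤ) → MKer (d + 1) (Fib d)}
    (hX : ∃ B : ℝ, ∀ κ u κ' u' x z a b, |X κ u κ' u' x z a b| ≤ B) (m k : ℕ) :
    transport (fun j => lin4 (cE₂ * (Lc : ℝ) ^ (2 * (d + 1))) (unitK (sfStep Lc j) (smStep d Lc j) (coDressKBmAt (toSite r) Lc (KInvStep (d := d) Lc j))) Lc) m k X -
        transport (fun j => lin4 (cE₂ * (Lc : ℝ) ^ (2 * (d + 1))) (unitK (sfStep Lc j) (smStep d Lc j) (KInvStep (d := d) Lc j)) Lc) m k X =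
      ∑ l ∈ Finset.range k, transport (fun j => lin4 (cE₂ * (Lc : ℝ) ^ (2 * (d + 1))) (unitK (sfStep Lc j) (smStep d Lc j) (coDressKBmAt (toSite r) Lc (KInvStep (d := d) Lc j))) Lc) (m + l + 1) (k - 1 - l)
        (lin4 (cE₂ * (Lc : ℝ) ^ (2 * (d + 1))) (unitK (sfStep Lc (m + l)) (smStep d Lc (m + l)) (coDressKBmAt (toSite r) Lc (KInvStep (d := d) Lc (m + l)))) Lc
            (transport (fun j => lin4 (cE₂ * (Lc : ℝ) ^ (2 * (d + 1))) (unitK (sfStep Lc j) (smStep d Lc j) (KInvStep (d := d) Lc j)) Lc) m l X) -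
          lin4 (cE₂ * (Lc : ℝ) ^ (2 * (d + 1))) (unitK (sfStep Lc (m + l)) (smStep d Lc (m + l)) (KInvStep (d := d) Lc (m + l))) Lc
            (transport (fun j => lin4 (cE₂ * (Lc : ℝ) ^ (2 * (d + 1))) (unitK (sfStep Lc j) (smStep d Lc j) (KInvStep (d := d) Lc j)) Lc) m l X)) :=
  transport_sub_transport_eq_sum_of_letters (fun j => coDressKBmAt (toSite r) Lc (KInvStep (d := d) Lc j)) (fun j => KInvStep (d := d) Lc j) cE₂
    (fun j => decays_coDressKBmAt_KInvStep (d := d) hr j) (fun j => decays_KInvStep (d := d) (Lc := Lc) j) hX m k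

end Comb

end Summit.QuantumFields.BalabanUV.Beta.GAN24.T2RecHybridSplit

end
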